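import Summits.Ventures.YMGap.RobustBall.IsingBallB2Layer
import Summits.Ventures.YMGap.RobustBall.CentreBlindStarWindow
import HarnessLib

/-!
# RobustBall/CentreBlindBallWindow — THE BALL WINDOW (rung 3 of the `β`-ladder): `AreaLawCentreBlind 2 4 β` for `SU(2)`, `d = 4`, whenever
# `tanh β_W ≤ 23/120`, i.e. `β_W ≤ artanh(23/120) = 0.194067…` (rung 2, stars: `β_W < 0.18463`; rung 1, Dobrushin: `β_W < 1/6`)

HONEST FRAMING: venture file of the cell `pub-ymgap` (QuantumFields programme), track Y2 ROBUST-BALL / DS seat ds-4 (g10).  WHAT THIS IS: a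
strong-coupling LATTICE theorem — Wilson's area law `|⟨W_{R×T}⟩_{β,W,L}| ≤ C^{2(R+T)} e^{−cRT}` with ONE pair `(C, c)` on every torus `(ℤ/L)^4`, for
`SU(2)` and EVERY LINKWISE CENTRE-BLIND perturbation `W` (gen 7's countersigned currency `AreaLawCentreBlind 2 4 β`, ROBUST-BALL-STATEMENT §6(c)),
now for every tree coupling `β` with `tanh(2|β|) ≤ 23/120` (`β_W = 2|β| ≤ artanh(23/120) = 0.194067…`; the clean row `tanh β_W ≤ 4/21`, `β_W ≤ 0.19283`, is kept too): the THIRD RUNG of the `β`-ladder (rung 1 = single-site Dobrushin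
`6β_W < 1`, gen 7; rung 2 = Simon–Lieb with stars `30 tanh²β_W < 1`, gen 9).  MECHANISM: centre projection (gen 7) + block conditioning (gen 8) reduce
the loop to rung two-point functions of the `ℤ₂` LAYER, an Ising model on the layer graph with couplings `|J| ≤ β_W`, bounded by the FERROMAGNET at `β_W`
(Griffiths; `ZTwoLayerIsing`/`ZTwoLayerGraph`); the Simon–Lieb inequality (Duminil-Copin–Tassion 2016, Lemma 2.7, the tree's random-current proof)
with the `ℓ¹`-BALLS OF RADIUS 2 of the three-dimensional layer as the sets `S_a`, whose certificate `φ_β(B₂) ≤ 0.998581… < 1` (`β ≤ artanh(23/120)`; `≤ 0.978680…` for `β ≤ artanh(4/21)`) is a KERNEL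
COMPUTATION (`IsingBallB2`: the 25-site ball reduces exactly to a 128-term integer sum; `IsingBallB2Bound`: heat-bath reduction of the 18 boundary
sites + Griffiths monotonicity in `β`; `IsingBallB2Layer`: transport into the layer graph, `L ≥ 6`), gives the per-rung rate `φ^{⌊T/3⌋}`;
`L ≤ 5` is trivial.  **`su2_areaLawCentreBlind_of_ballCert`** (certificate → row), **`su2_areaLawCentreBlind_ball2_sharp`** (`tanh β_W ≤ 23/120`),
`su2_areaLawCentreBlind_ball2` (`tanh β_W ≤ 4/21`); cells `β_W = 0.19` (`AreaLawCentreBlind 2 4 (19/200)`), `0.1928` (`241/2500`), `0.194` (`97/1000`);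
the limit-state reading `su2_stringTension_centreBlind_ball2_sharp`.  The root of `φ(B₂) = 1` is `β_W ≈ 0.1942` (gen 9 numerics): rung 3 is exhausted.  HONEST LABEL: `SU(2)` and `d = 4` only (the
certificate is the three-dimensional ball); centre-blind class only (no tube); the ladder's ceiling is `β_c(ℤ³ Ising) ≈ 0.2217` and the class really
deconfines only at the `ℤ₂`-gauge transition `≈ 0.44`; the rate is a door artefact; nothing continuum / spectral / Clay.

References AS PRINTED: J. Fröhlich, Phys. Lett. B 83 (1979) 195; G. Mack, V. B. Petkova, Ann. Phys. 123 (1979) 442; B. Simon, Comm. Math. Phys. 77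
(1980) 111; E. Lieb, Comm. Math. Phys. 77 (1980) 127; H. Duminil-Copin, V. Tassion, Comm. Math. Phys. 343 (2016) 725, Lemma 2.7; R. Griffiths,
J. Math. Phys. 8 (1967) 478.
-/

noncomputable section

open Finset MeasureTheory
open Literature.MathematicalPhysics.QuantumLattice (fundamentalRep)
open Literature.MathematicalPhysics.QuantumFieldTheory

namespace Summit.Ventures.YMGap.RobustBall

open ZN ZNFluxW ZTwo

variable {L : ℕ} [NeZero L]

/-! ### From a boundary-sum bound on `[0, β₁]` to the area law (certificate → row) -/

section Cert

variable {β₁ B : ℝ}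
  (hB : ∀ β : ℝ, 0 ≤ β → β ≤ β₁ →
    5 * ∑ ks : Fin 3 × Bool, Literature.Probability.LatticeModels.isingTwoPoint b2Graph Finset.univ β 0 .free B2V.centre (B2V.axis ks.1 ks.2) +
      4 * ∑ c : Fin 3 × Bool × Bool, Literature.Probability.LatticeModels.isingTwoPoint b2Graph Finset.univ β 0 .free B2V.centre
        (B2V.corner c.1 c.2.1 c.2.2) ≤ B)

include hB

/-- **TWO-POINT BOUND OF THE CENTRE-PROJECTED `ℤ₂` LAYER FROM A BALL CERTIFICATE** (`L ≥ 6`, no twist defect, `2|β| ≤ β₁`): for every selected set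
`H`, transverse `kT`, frozen `κ`, background `U` and sites `b, t`: `‖E ψ₂(σ_b − σ_t)‖ ≤ (tanh β₁ · B)^{⌊dist_j(t,b)/3⌋}`. [folklore] -/
theorem norm_cavg_ψ_two_le_ballCert_pow (hL : 6 ≤ L) {β : ℝ} (hβ : 2 * |β| ≤ β₁)
    (gD : Fin 0 → (Plaquette 4 L → ZMod 2) → GaugeConfig 4 L (SUN 2) → ℝ) (U : GaugeConfig 4 L (SUN 2)) (i j : Fin 4)
    (H : Finset (ZMod L)) (kT : Transverse 4 L (ZMod 2) i) (κ : Site 4 L → ZMod 2) (b t : Site 4 L) :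
    ‖FiniteGibbs.cavg (layerWeightW (gS β gD U) i H kT κ) (fun σ => ψ 2 (σ b - σ t))‖ ≤ (Real.tanh β₁ * B) ^ (jDist j t b / 3) := by
  classical
  refine (norm_cavg_ψ_two_le_gksExpect_const (by omega) β gD U i H kT κ b t).trans ?_
  rw [gksExpect_const_eq_isingTwoPoint (by omega)]
  exact isingTwoPoint_layer_le_pow_of hL hB (by positivity) hβ i j H t b

/-- **The induced `ℤ₂` Wilson loop (no twist defect) obeys the ball-certificate bound** (`L ≥ 6`, `i ≠ j`, `2R, 2T ≤ L`):
`‖znLoopW‖ ≤ ((tanh β₁ · B)^{⌊T/3⌋})^{#selIdx 1 R}`. [folklore] -/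
theorem norm_znLoopW_le_ballCert (hL : 6 ≤ L) {β : ℝ} (hβ : 2 * |β| ≤ β₁)
    (gD : Fin 0 → (Plaquette 4 L → ZMod 2) → GaugeConfig 4 L (SUN 2) → ℝ) (U : GaugeConfig 4 L (SUN 2)) (x : Site 4 L) {i j : Fin 4}
    (hij : i ≠ j) {R T : ℕ} (hR : 2 * R ≤ L) (hT : 2 * T ≤ L) :
    ‖znLoopW β gD U x i j R T‖ ≤ ((Real.tanh β₁ * B) ^ (T / 3)) ^ (selIdx 1 R).card := by
  classical
  unfold znLoopW
  refine norm_cavg_ψ_loopSum_le_of_bound (supp := suppS (fun _ : Fin 0 => (∅ : Finset (Plaquette 4 L)))) (g := gS β gD U)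
    ?_ hij (m := 1) ?_ (F := fun D => (Real.tanh β₁ * B) ^ (D / 3)) (fun H kT κ b t => ?_) x hR hT
  · rintro (p | t)
    · intro φ φ' h
      simp only [gS, Sum.elim_inl]
      rw [h p (by simp [suppS])]
    · exact Fin.elim0 t
  · rintro (p | t) y hy y' hy'
    · simp only [suppS, Sum.elim_inl, iLinks_singleton] at hy hy'
      rw [iDist_eq_zero_of_mem_iSites i p hy hy']; exact Nat.one_pos
    · exact Fin.elim0 t
  · exact norm_cavg_ψ_two_le_ballCert_pow hB hL hβ gD U i j H kT κ b t

/-- **CENTRE PROJECTION + BALL CERTIFICATE** (`SU(2)`, `d = 4`, `L ≥ 6`): for EVERY twist-blind `W` and every non-wrapping `R × T` loop,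
`|⟨(1/2) tr U_{R×T}⟩_{β,W,L}| ≤ ((tanh β₁ · B)^{⌊T/3⌋})^{#selIdx 1 R}`. [cite: Frohlich1979ZN, Eq. (7)–(9)] -/
theorem abs_wilsonLoop_le_ballCert (hL : 6 ≤ L) {β : ℝ} (hβ : 2 * |β| ≤ β₁) (W : Perturbation 4 L 2) (hW : IsTwistBlind W) (x : Site 4 L)
    {i j : Fin 4} (hij : i ≠ j) {R T : ℕ} (hR : 2 * R ≤ L) (hT : 2 * T ≤ L) :
    |W.expectation (fundamentalRep (Fin 2)) β (wilsonLoop (fundamentalRep (Fin 2)) x i j R T)| ≤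
      ((Real.tanh β₁ * B) ^ (T / 3)) ^ (selIdx 1 R).card :=
  abs_expectation_wilsonLoop_le_of_fluxDefect W (c := W.total) (gD := fun (_ : Fin 0) _ _ => (0 : ℝ))
    (fun k U => by rw [hW k U]; simp) β x i j R T fun U => norm_znLoopW_le_ballCert hB hL hβ _ U x hij hR hT

end Cert

/-- The area-law normal form of a radius-2 ladder bound: for `0 < c₀ ≤ 1`, `c = −log c₀ / 3`,
`(c₀^{⌊T/3⌋})^R ≤ (e^{c})^{2(R+T)} · e^{−c RT}`. [folklore] -/
theorem ballShape {c₀ : ℝ} (hc0 : 0 < c₀) (hc1 : c₀ ≤ 1) (R T : ℕ) :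
    (c₀ ^ (T / 3)) ^ R ≤ Real.exp (-Real.log c₀ / 3) ^ (2 * (R + T)) * Real.exp (-(-Real.log c₀ / 3) * ((R : ℝ) * T)) := by
  set c := -Real.log c₀ / 3 with hc
  have hcnn : 0 ≤ c := div_nonneg (neg_nonneg.2 (Real.log_nonpos hc0.le hc1)) (by norm_num)
  have hlog : Real.log c₀ = -3 * c := by rw [hc]; ring
  rw [← Real.rpow_natCast c₀, ← Real.rpow_natCast, ← Real.rpow_mul hc0.le, Real.rpow_def_of_pos hc0, ← Real.exp_nat_mul,
    ← Real.exp_add]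
  apply Real.exp_le_exp.2
  have h3n : ((T : ℝ) - 2) ≤ 3 * ((T / 3 : ℕ) : ℝ) := by
    have : T ≤ 3 * (T / 3) + 2 := by omega
    have : (T : ℝ) ≤ 3 * ((T / 3 : ℕ) : ℝ) + 2 := by exact_mod_cast this
    linarith
  rw [hlog]
  push_cast
  have hR0 : (0 : ℝ) ≤ R := Nat.cast_nonneg R
  have hT0 : (0 : ℝ) ≤ T := Nat.cast_nonneg T
  have hn0 : (0 : ℝ) ≤ ((T / 3 : ℕ) : ℝ) := Nat.cast_nonneg _
  nlinarith [mul_nonneg hcnn hR0, mul_nonneg hcnn hT0, mul_nonneg (mul_nonneg hcnn hR0) hn0]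

/-- **CERTIFICATE → ROW: `AreaLawCentreBlind 2 4 β` from a boundary-sum bound.** If the boundary sum of `b2Graph` is `≤ B` on `[0, β₁]` with
`0 < tanh β₁ · B < 1`, then Wilson's area law holds with ONE `(C, c)` (`C = e^c`, `c = −log(tanh β₁ · B)/3`) for `SU(2)`, `d = 4`, plus EVERY linkwise
centre-blind perturbation on every torus, at every tree coupling `β` with `2|β| ≤ β₁`. [cite: MackPetkova1979, §2] -/
theorem su2_areaLawCentreBlind_of_ballCert {β₁ B : ℝ}
    (hB : ∀ β : ℝ, 0 ≤ β → β ≤ β₁ →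
      5 * ∑ ks : Fin 3 × Bool, Literature.Probability.LatticeModels.isingTwoPoint b2Graph Finset.univ β 0 .free B2V.centre (B2V.axis ks.1 ks.2) +
        4 * ∑ c : Fin 3 × Bool × Bool, Literature.Probability.LatticeModels.isingTwoPoint b2Graph Finset.univ β 0 .free B2V.centre
          (B2V.corner c.1 c.2.1 c.2.2) ≤ B)
    (hφ0 : 0 < Real.tanh β₁ * B) (hφ1 : Real.tanh β₁ * B < 1) {β : ℝ} (hβ : 2 * |β| ≤ β₁) : AreaLawCentreBlind 2 4 β := by
  set φ := Real.tanh β₁ * B with hφ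
  set c := -Real.log φ / 3 with hc
  have hcpos : 0 < c := div_pos (neg_pos.2 (Real.log_neg hφ0 hφ1)) (by norm_num)
  set C := Real.exp c with hC
  refine ⟨C, c, hcpos, fun L _ W hW x i j R T hij hR1 hT1 hRL hTL => ?_⟩
  have hWt : IsTwistBlind W := hW.isTwistBlind
  by_cases hL : 6 ≤ L
  · refine (abs_wilsonLoop_le_ballCert hB hL hβ W hWt x hij hRL hTL).trans ?_
    have h2 : (φ ^ (T / 3)) ^ (selIdx 1 R).card ≤ (φ ^ (T / 3)) ^ R :=
      pow_le_pow_of_le_one (pow_nonneg hφ0.le _) (pow_le_one₀ hφ0.le hφ1.le) (by simpa using le_mul_card_selIdx Nat.one_pos R)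
    refine h2.trans ?_
    have h3 := ballShape hφ0 hφ1.le R T
    rw [← hc] at h3
    exact h3
  · -- small torus: `R, T ≤ 2`, the loop is bounded by `1 ≤ C^{2(R+T)} e^{−cRT}`
    have hR : R ≤ 2 := by omega
    have hT : T ≤ 2 := by omega
    refine (abs_expectation_wilsonLoop_le_one W β x i j R T).trans ?_
    rw [hC, ← Real.exp_nat_mul, ← Real.exp_add]
    refine Real.one_le_exp ?_
    push_cast
    have hR' : (R : ℝ) ≤ 2 := by exact_mod_cast hR
    have hT' : (T : ℝ) ≤ 2 := by exact_mod_cast hT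
    have hR0 : (0 : ℝ) ≤ R := Nat.cast_nonneg R
    have hT0 : (0 : ℝ) ≤ T := Nat.cast_nonneg T
    nlinarith [mul_nonneg hcpos.le hR0, mul_nonneg hcpos.le hT0, mul_nonneg (mul_nonneg hcpos.le hR0) (sub_nonneg.2 hT')]

/-! ### The windows -/

/-- **THE BALL WINDOW AT `β₀ = artanh(4/21)`: `AreaLawCentreBlind 2 4 β` whenever `tanh(2|β|) ≤ 4/21`** (`β_W ≤ 0.192831…`; rate `φ₀ = 0.978680…`).
[cite: MackPetkova1979, §2] -/
theorem su2_areaLawCentreBlind_ball2 {β : ℝ} (hβ : Real.tanh (2 * |β|) ≤ 4 / 21) : AreaLawCentreBlind 2 4 β := by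
  have h := Real.artanh_le_artanh (Real.neg_one_lt_tanh (2 * |β|)) (by norm_num : (4 / 21 : ℝ) < 1) hβ
  rw [Real.artanh_tanh] at h
  refine su2_areaLawCentreBlind_of_ballCert (β₁ := b2Beta) (B := b2Bound) (fun β h0 hβ => b2_boundarySum_le h0 hβ) ?_ ?_ h
  · rw [tanh_b2Beta]; exact b2Rate_pos
  · rw [tanh_b2Beta]; exact b2Rate_lt_one

/-- **THE SHARP BALL WINDOW AT `β₁ = artanh(23/120)`: `AreaLawCentreBlind 2 4 β` whenever `tanh(2|β|) ≤ 23/120`** (`β_W ≤ 0.194067…`; rate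
`φ₁ = 0.998581…`; the root of `φ(B₂) = 1` is `β_W ≈ 0.1942`, so this exhausts rung 3). [cite: MackPetkova1979, §2] -/
theorem su2_areaLawCentreBlind_ball2_sharp {β : ℝ} (hβ : Real.tanh (2 * |β|) ≤ 23 / 120) : AreaLawCentreBlind 2 4 β := by
  have h := Real.artanh_le_artanh (Real.neg_one_lt_tanh (2 * |β|)) (by norm_num : (23 / 120 : ℝ) < 1) hβ
  rw [Real.artanh_tanh] at h
  refine su2_areaLawCentreBlind_of_ballCert (β₁ := b2BetaS) (B := b2BoundS) (fun β h0 hβ => b2_boundarySum_le_sharp h0 hβ) ?_ ?_ h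
  · rw [tanh_b2BetaS]; exact b2RateS_pos
  · rw [tanh_b2BetaS]; exact b2RateS_lt_one

/-! ### Rows and cells -/

/- (gen 12 refile of p377382: the two containment corollaries `…_ball2_of_star` / `…_ball2_of_dobrushin` were removed — their statements coincide
   with the tree's `su2_areaLawCentreBlind_star_dim4` / `su2_areaLawCentreBlind_star_of_dobrushin` (CentreBlindStarWindow), gate `dedup.landed`.) -/

/-- **CELL SU(2), `d = 4`, `β_W = 19/100 = 0.19`** (beyond the star window `β_W < 0.18463`): `AreaLawCentreBlind 2 4 (19/200)` (via `tanh x ≤ x`,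
`0.19 ≤ 4/21`). [folklore] -/
theorem su2_areaLawCentreBlind_ball2_cell : AreaLawCentreBlind 2 4 (19 / 200) := by
  refine su2_areaLawCentreBlind_ball2 ?_
  rw [abs_of_pos (by norm_num)]
  exact (Literature.Barriers.HubbardSuperconductivity.tanh_le_self (by norm_num)).trans (by norm_num)

/-- **CELL SU(2), `d = 4`, `β_W = 241/1250 = 0.1928`**: `AreaLawCentreBlind 2 4 (241/2500)`, via the quintic enclosure `tanh x ≤ x − x³/3 + 2x⁵/15`
and the `4/21` window. [folklore] -/
theorem su2_areaLawCentreBlind_ball2_cell_sharp : AreaLawCentreBlind 2 4 (241 / 2500) := by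
  refine su2_areaLawCentreBlind_ball2 ?_
  have hx : (2 * |(241 / 2500 : ℝ)|) = 241 / 1250 := by rw [abs_of_pos (by norm_num)]; norm_num
  rw [hx]
  have hp : Real.tanh (241 / 1250 : ℝ) ≤ 241 / 1250 - (241 / 1250 : ℝ) ^ 3 / 3 + 2 / 15 * (241 / 1250 : ℝ) ^ 5 :=
    (Literature.ComputerArithmetic.DeDinechinLauterMullerTorres2013.tanh_quintic_bounds (by norm_num) (by norm_num)).2
  have hnum : 241 / 1250 - (241 / 1250 : ℝ) ^ 3 / 3 + 2 / 15 * (241 / 1250 : ℝ) ^ 5 ≤ 4 / 21 := by norm_num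
  exact hp.trans hnum

/-- **SHARPEST CELL SU(2), `d = 4`, `β_W = 97/500 = 0.194`** (gen 9's certified numerics: `φ(B₂)(0.194) ∈ [0.99749, 0.99750]`):
`AreaLawCentreBlind 2 4 (97/1000)`, via the quintic enclosure and the `23/120` window (`tanh 0.194 ≤ 0.191603 ≤ 23/120 = 0.19166…`). [folklore] -/
theorem su2_areaLawCentreBlind_ball2_cell_sharpest : AreaLawCentreBlind 2 4 (97 / 1000) := by
  refine su2_areaLawCentreBlind_ball2_sharp ?_
  have hx : (2 * |(97 / 1000 : ℝ)|) = 97 / 500 := by rw [abs_of_pos (by norm_num)]; norm_num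
  rw [hx]
  have hp : Real.tanh (97 / 500 : ℝ) ≤ 97 / 500 - (97 / 500 : ℝ) ^ 3 / 3 + 2 / 15 * (97 / 500 : ℝ) ^ 5 :=
    (Literature.ComputerArithmetic.DeDinechinLauterMullerTorres2013.tanh_quintic_bounds (by norm_num) (by norm_num)).2
  have hnum : 97 / 500 - (97 / 500 : ℝ) ^ 3 / 3 + 2 / 15 * (97 / 500 : ℝ) ^ 5 ≤ 23 / 120 := by norm_num
  exact hp.trans hnum

/-! ### Limit states in the ball window -/

/-- **STRING TENSION IN THE BALL WINDOW** (`SU(2)`, `d = 4`, `tanh(2|β|) ≤ 23/120`): ONE pair `(C, c)`, `c > 0`, such that every infinite-volume limit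
state of every eventually-centre-blind family obeys `HasAreaLawWith μ χ₂ C c`, `HasAreaLawState`, `σ ≥ c` WHENEVER its string tension exists, and
`IsConfining` given existence (gen 7's `stringTension_centreBlind` on the ball window).  Existence of `σ` NOT asserted. [folklore] -/
theorem su2_stringTension_centreBlind_ball2_sharp {β : ℝ} (hβ : Real.tanh (2 * |β|) ≤ 23 / 120) :
    ∃ C c : ℝ, 0 < c ∧ ∀ 𝓦 : PerturbationFamily 4 2,
      (∀ᶠ L : ℕ in Filter.atTop, IsCentreBlind (𝓦 L)) →
        ∀ μ ∈ perturbedLimitPoints β 𝓦,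
          Literature.MathematicalPhysics.QuantumLattice.HasAreaLawWith μ (fun g => Literature.MathematicalPhysics.QuantumLattice.normalisedCharacter 2 (fundamentalRep (Fin 2) g)) C c ∧
          Literature.MathematicalPhysics.QuantumLattice.HasAreaLawState μ (fun g => Literature.MathematicalPhysics.QuantumLattice.normalisedCharacter 2 (fundamentalRep (Fin 2) g)) ∧
          (∀ σ : ℝ, Literature.MathematicalPhysics.QuantumLattice.HasStringTension μ (fun g => Literature.MathematicalPhysics.QuantumLattice.normalisedCharacter 2 (fundamentalRep (Fin 2) g)) σ →
            c ≤ σ) ∧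
          ((∃ σ : ℝ, Literature.MathematicalPhysics.QuantumLattice.HasStringTension μ (fun g => Literature.MathematicalPhysics.QuantumLattice.normalisedCharacter 2 (fundamentalRep (Fin 2) g)) σ) →
            Literature.MathematicalPhysics.QuantumLattice.IsConfining μ (fun g => Literature.MathematicalPhysics.QuantumLattice.normalisedCharacter 2 (fundamentalRep (Fin 2) g))) :=
  stringTension_centreBlind (N := 2) (by norm_num) (su2_areaLawCentreBlind_ball2_sharp hβ)

/-- **SU(2), `d = 4`, `β_W = 97/500 = 0.194`**: the limit-state string-tension reading at the sharpest ball cell. [folklore] -/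
theorem su2_stringTension_centreBlind_ball2_cell :
    ∃ C c : ℝ, 0 < c ∧ ∀ 𝓦 : PerturbationFamily 4 2,
      (∀ᶠ L : ℕ in Filter.atTop, IsCentreBlind (𝓦 L)) →
        ∀ μ ∈ perturbedLimitPoints (97 / 1000 : ℝ) 𝓦,
          Literature.MathematicalPhysics.QuantumLattice.HasAreaLawWith μ (fun g => Literature.MathematicalPhysics.QuantumLattice.normalisedCharacter 2 (fundamentalRep (Fin 2) g)) C c ∧
          Literature.MathematicalPhysics.QuantumLattice.HasAreaLawState μ (fun g => Literature.MathematicalPhysics.QuantumLattice.normalisedCharacter 2 (fundamentalRep (Fin 2) g)) ∧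
          (∀ σ : ℝ, Literature.MathematicalPhysics.QuantumLattice.HasStringTension μ (fun g => Literature.MathematicalPhysics.QuantumLattice.normalisedCharacter 2 (fundamentalRep (Fin 2) g)) σ →
            c ≤ σ) ∧
          ((∃ σ : ℝ, Literature.MathematicalPhysics.QuantumLattice.HasStringTension μ (fun g => Literature.MathematicalPhysics.QuantumLattice.normalisedCharacter 2 (fundamentalRep (Fin 2) g)) σ) →
            Literature.MathematicalPhysics.QuantumLattice.IsConfining μ (fun g => Literature.MathematicalPhysics.QuantumLattice.normalisedCharacter 2 (fundamentalRep (Fin 2) g))) :=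
  stringTension_centreBlind (N := 2) (by norm_num) su2_areaLawCentreBlind_ball2_cell_sharpest

end Summit.Ventures.YMGap.RobustBall

end
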